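import Mathlib.Analysis.SpecialFunctions.Pow.Real
import Literature.Probability.LatticeModels.LatticeGraph
import Literature.Probability.LatticeModels.ThermodynamicLimit
import Literature.Probability.LatticeModels.CorrelationDecay
import Literature.Probability.LatticeModels.IsingModel
import Literature.Probability.LatticeModels.IsingThermodynamics
import Literature.Probability.LatticeModels.GibbsSpecification
import Literature.Probability.LatticeModels.ScalingLimit
import Literature.Probability.LatticeModels.ConformalCovariance
import HarnessLib

-- provenance: harness21/H21/H21/Statements/CritIsing/Sharpness.lean @ 83d3230 (interim HEAD d8f2665); M5 mechanical rewrite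
/-!
# Critical Ising family: sharpness, continuity at `β_c`, critical two-point bounds

Trunk G02 (T-STATMECH), statement file `Statements/CritIsing/Sharpness.lean`
(family `crit-ising`, namespace `Literature.CritIsing`).

## Covered statement ids

* **crit-ising.S08** — sharpness of the phase transition of the nearest-neighbour Ising model on
  `ℤ^d`, `d ≥ 2`: exponential decay of `⟨σ₀σ_x⟩` for `β < β_c`
  (`twoPoint_exponentialDecay_of_lt_criticalBeta`), hence `β_c = sup {β | χ(β) < ∞}`
  (`criticalBeta_eq_sSup_susceptibility_finite`), and the mean-field lower bound
  `m*(β) ≥ c (β - β_c)^{1/2}` in a right neighbourhood of `β_c` (`meanField_lower_bound`).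
  Aizenman–Barsky–Fernández, *The phase transition in a general class of Ising-type models is
  sharp*, J. Stat. Phys. **47** (1987) 343, Thm. 1; Duminil-Copin–Tassion, *A new proof of the
  sharpness of the phase transition for Bernoulli percolation and the Ising model*,
  Comm. Math. Phys. **343** (2016) 725, Thm. 1.2.
* **crit-ising.S09** — continuity of the magnetisation at `β_c` for `d ≥ 3`
  (`spontaneousMagnetization_criticalBeta_eq_zero`), uniqueness of the infinite-volume Gibbs
  measure at `(β_c, 0)` (`hasUniqueGibbsMeasure_criticalBeta`) and, as a corollary,
  well-definedness of the critical correlators independently of the boundary condition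
  (`criticalCorr_wellDefined`). Aizenman–Duminil-Copin–Sidoravicius, *Random currents and
  continuity of Ising model's spontaneous magnetization*, Comm. Math. Phys. **334** (2015) 719,
  Thm. 1.2 with Cor. 1.5(1) (`d = 3`; the paper's 1.1 is a Proposition); Aizenman–Fernández,
  J. Stat. Phys. **44** (1986) 393 (`d ≥ 4`).
* **crit-ising.S10** — two-sided power-law bounds on the critical two-point function for
  `d ≥ 3`, `c ‖x‖^{-(d-1)} ≤ ⟨σ₀σ_x⟩_{β_c} ≤ C ‖x‖^{-(d-2)}` (`criticalTwoPoint_bounds`; Simon,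
  Comm. Math. Phys. **77** (1980) 111; Lieb, Comm. Math. Phys. **77** (1980) 127 (lower bound);
  Fröhlich–Simon–Spencer, Comm. Math. Phys. **50** (1976) 79 with Aizenman–Fernández 1986 /
  ADS 2015 for the passage to `β = β_c` (infrared upper bound); as recorded in Duminil-Copin,
  *100 years of the (critical) Ising model on the hypercubic lattice*, ICM 2022, §1), and the
  consequence for `ℤ³`: any scaling dimension `Δ` of a scale-covariant non-degenerate pointwise
  scaling limit of the critical correlators lies in `[1/2, 1]` (`scalingDimension_mem_Icc`).

## Conventions and design choices

* Everything is imported from the StatMech prelude: `twoPointFree`, `susceptibility`,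
  `criticalBeta`, `spontaneousMagnetization`, `criticalTwoPoint`, `criticalCorr` (P6),
  `isingExpect`, `BoundaryCondition` (P5), `HasBoxLimit` (P2), `HasExponentialDecay` (P4),
  `isingSpecification`, `HasUniqueGibbsMeasure` (P17), `HasPointwiseScalingLimit`,
  `IsNondegenerateTwoPoint` (P8), `IsScaleCovariant` (P9). Nothing new is *defined* in this file.
  Mathlib has no Ising model / Gibbs state / critical temperature (searched `Ising`, `Gibbs`,
  `criticalTemperature`, `susceptib`); the only Mathlib anchors are `Real.exp`, `Real.sqrt`,
  `Real.rpow`, `sSup`, `Set.Icc/Ioo/Ioc` and the Pi sup norm on `Site d = Fin d → ℤ` (outline §0).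
* Norm: `‖x‖` is the sup norm of `x : Fin d → ℤ` (outline §0); exponential and power-law rates
  are therefore `ℓ^∞`-rates, equivalent to Euclidean ones up to constants depending on `d`.
* S08 is stated for the *free* state two-point function `⟨σ₀σ_x⟩^∅_{β,0}` (which is the one summed
  in `susceptibility`); for `β < β_c` the Gibbs measure is unique, so this is also `⟨σ₀σ_x⟩⁺`.
  Duminil-Copin–Tassion state the bound without a prefactor, `⟨σ₀σ_x⟩⁺_β ≤ e^{-c‖x‖}`; we copy
  that shape. The mean-field bound is stated in the right-neighbourhood form fixed by the outline
  (§3): the global form `∀ β > β_c` is false as `m* ≤ 1`.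
* S09/S10 carry `3 ≤ d` as in the cited theorems (for `d = 2` continuity is Onsager–Yang, not
  the cited result, and S10's upper bound with exponent `d - 2 = 0` is not the planar decay
  `‖x‖^{-1/4}`). `criticalBeta d` is junk (`= 0`) for `d ≤ 1`; all statements carry `2 ≤ d` or
  `3 ≤ d`.
* `scalingDimension_mem_Icc` is the outline's rendering of "hence on `ℤ³` any exponent `Δ`
  satisfies `1/2 ≤ Δ ≤ 1`": if the critical correlators `criticalCorr 3` admit a pointwise
  scaling limit `S` with a positive renormalisation `ρ` and `S` is scale-covariant with dimension
  `Δ` and has a non-degenerate two-point function, then `ρ(δ)/ρ(δ/2) → 2^{-Δ}` and the two-sided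
  bounds of `criticalTwoPoint_bounds` force `1/2 ≤ Δ ≤ 1` (an elementary argument along the
  sequence `δ = 2^{-k}`; no regular-variation theory is needed).
* Proofs are `sorry` with citations (known theorems in print).
-/

noncomputable section

open MeasureTheory Filter Topology Literature.Probability.LatticeModels

namespace Literature.Probability.LatticeModels

variable {d : ℕ}

/-! ### crit-ising.S08: sharpness of the phase transition -/

/-- **crit-ising.S08** (exponential decay below `β_c`; Aizenman–Barsky–Fernández, J. Stat. Phys.
47 (1987), Thm. 1; Duminil-Copin–Tassion, CMP 343 (2016), Thm. 1.2). For the nearest-neighbour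
Ising model on `ℤ^d`, `d ≥ 2`, and `0 ≤ β < β_c(d)`, there is `c > 0` with
`⟨σ₀ σ_x⟩^∅_{β,0} ≤ exp (-c ‖x‖)` for every `x ∈ ℤ^d` (sup norm, outline §0). [cite: AizenmanBarskyFernandezJSP1987, Thm. 1] [cite: DuminilCopinTassionCMP2016, Thm. 1.2] -/
def twoPoint_exponentialDecay_of_lt_criticalBeta : Prop :=
  ∀ (hd : 2 ≤ d) {β : ℝ} (hβ : 0 ≤ β) (h : β < criticalBeta d),
    ∃ c > 0, ∀ x : Site d, twoPointFree d β x ≤ Real.exp (-c * ‖x‖)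

/-- **crit-ising.S08** (corollary in the language of P4; Aizenman–Barsky–Fernández 1987, Thm. 1;
Duminil-Copin–Tassion 2016, Thm. 1.2, combined with `0 ≤ ⟨σ₀σ_x⟩^∅` from the first Griffiths
inequality, Friedli–Velenik 2017, Thm. 3.20). Below `β_c` the free two-point function
`x ↦ ⟨σ₀ σ_x⟩^∅_{β,0}` has exponential decay in the sense of `HasExponentialDecay`. [cite: AizenmanBarskyFernandez1987, Thm. 1] -/
def hasExponentialDecay_twoPointFree_of_lt_criticalBeta : Prop :=
  ∀ (hd : 2 ≤ d) {β : ℝ} (hβ : 0 ≤ β) (h : β < criticalBeta d),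
    HasExponentialDecay (twoPointFree d β)

/-- **crit-ising.S08** (`β_c` is the susceptibility threshold; Aizenman–Barsky–Fernández,
J. Stat. Phys. 47 (1987), Thm. 1 and Cor.; Duminil-Copin–Tassion, CMP 343 (2016), Thm. 1.2;
divergence of `χ` at and above `β_c`: Simon, CMP 77 (1980), and Friedli–Velenik 2017, §3.7.4).
For `d ≥ 2`, `β_c(d) = sup {β ≥ 0 | χ(β) < ∞}`, where `χ(β) = ∑_x ⟨σ₀σ_x⟩^∅_{β,0} ∈ [0, ∞]` is
`susceptibility d β`. [cite: FriedliVelenik2017, §3.7.4] -/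
def criticalBeta_eq_sSup_susceptibility_finite : Prop :=
  ∀ (hd : 2 ≤ d),
    criticalBeta d = sSup {β : ℝ | 0 ≤ β ∧ susceptibility d β < ⊤}

/-- **crit-ising.S08** (mean-field lower bound on the magnetisation; Aizenman–Barsky–Fernández,
J. Stat. Phys. 47 (1987), Thm. 1 (ii); Duminil-Copin–Tassion, CMP 343 (2016), Thm. 1.2 (2)).
For `d ≥ 2` there are `c > 0` and `ε > 0` such that `m*(β) ≥ c (β - β_c)^{1/2}` for all
`β ∈ (β_c, β_c + ε)`. (Right-neighbourhood form, outline §3: the bound cannot hold for all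
`β > β_c` with a fixed `c` since `m*(β) ≤ 1`.) [cite: AizenmanBarskyFernandezJSP1987, Thm. 1 (ii)] [cite: DuminilCopinTassionCMP2016, Thm. 1.2 (2)] -/
def meanField_lower_bound : Prop :=
  ∀ (hd : 2 ≤ d),
    ∃ c > 0, ∃ ε > 0, ∀ β ∈ Set.Ioo (criticalBeta d) (criticalBeta d + ε),
      c * Real.sqrt (β - criticalBeta d) ≤ spontaneousMagnetization d β

/-! ### crit-ising.S09: continuity of the magnetisation at `β_c`, `d ≥ 3` -/

/-- **crit-ising.S09** (Aizenman–Duminil-Copin–Sidoravicius, CMP 334 (2015), Thm. 1.2 with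
Cor. 1.5(1) for `d = 3` — Thm. 1.2: `M̃_LRO(β_c) = 0 ⇒ m*(β_c) = 0` under C1–C4, Cor. 1.5(1): every
reflection-positive ferromagnetic Ising model in `d > 2`, in particular nearest-neighbour `ℤ³`; the paper's
1.1 is a Proposition; Aizenman–Fernández, J. Stat. Phys. 44 (1986) for `d ≥ 4`). For the nearest-neighbour
Ising model on `ℤ^d`, `d ≥ 3`, the spontaneous magnetisation vanishes at the critical point:
`m*(β_c) = 0`. [cite: AizenmanDuminilCopinSidoraviciusCMP2015, Thm. 1.2 with Cor. 1.5(1) (d = 3)] [cite: AizenmanFernandezJSP1986, main theorem (d ≥ 4)] -/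
def spontaneousMagnetization_criticalBeta_eq_zero : Prop :=
  ∀ (hd : 3 ≤ d),
    spontaneousMagnetization d (criticalBeta d) = 0

/-- **crit-ising.S09** (uniqueness at criticality; Aizenman–Duminil-Copin–Sidoravicius, CMP 334
(2015), Thm. 1.2 (second assertion: a unique Gibbs state at `β_c`) with Cor. 1.5(1); `m*(β) = 0 ⇒ |𝒢(β,0)| = 1` is
Friedli–Velenik 2017, Thm. 3.28 with Prop. 3.29 / Thm. 6.63). For `d ≥ 3` the Ising specification
on `ℤ^d` at `(β_c, h = 0)` admits exactly one infinite-volume Gibbs measure. [cite: FriedliVelenik2017, Thm. 3.28 with Prop. 3.29 / Thm. 6.63] -/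
def hasUniqueGibbsMeasure_criticalBeta : Prop :=
  ∀ (hd : 3 ≤ d),
    HasUniqueGibbsMeasure (isingSpecification (zdGraph d) (criticalBeta d) 0)

/-- **crit-ising.S09** (corollary: the critical state `⟨·⟩_{β_c}` is well defined;
Aizenman–Duminil-Copin–Sidoravicius, CMP 334 (2015), Thm. 1.2 with Cor. 1.5(1); Friedli–Velenik 2017, Thm. 3.17,
Lemma 3.30 and Thm. 3.28). For `d ≥ 3`, every `n` and every `x : Fin n → ℤ^d`, the finite-volume
expectations `⟨∏ᵢ σ_{xᵢ}⟩_{B(L);β_c,0}^{bc}` converge as `L → ∞` to the same limit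
`criticalCorr d n x` for the free, plus and minus boundary conditions. [cite: FriedliVelenik2017, Thm. 3.17  Lemma 3.30 and Thm. 3.28] -/
def criticalCorr_wellDefined : Prop :=
  ∀ (hd : 3 ≤ d) (n : ℕ) (x : Fin n → Site d),
    ∀ bc ∈ ({.free, .plus, .minus} : Set (BoundaryCondition (Site d))),
      HasBoxLimit (fun Λ => isingExpect (zdGraph d) Λ (criticalBeta d) 0 bc (spinMonomial x))
        (criticalCorr d n x)

/-! ### crit-ising.S10: critical two-point bounds for `d ≥ 3` and `1/2 ≤ Δ ≤ 1` on `ℤ³` -/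

/-- **crit-ising.S10** (two-point bounds at `β_c`, `d ≥ 3`; lower bound: Simon, CMP 77 (1980)
111, Thm. 1 with Lieb's improvement, CMP 77 (1980) 127; upper bound: the infrared bound of
Fröhlich–Simon–Spencer, CMP 50 (1976) 79, transferred to `x`-space and to `β = β_c`, cf.
Aizenman–Fernández 1986 and Aizenman–Duminil-Copin–Sidoravicius 2015, (1.5); summary in
Duminil-Copin, ICM 2022, §1). There are constants `0 < c` and `C` such that for every `x ≠ 0` in
`ℤ^d`, `c ‖x‖^{-(d-1)} ≤ ⟨σ₀ σ_x⟩⁺_{β_c,0} ≤ C ‖x‖^{-(d-2)}` (sup norm, real powers `Real.rpow`). [cite: AizenmanFernandez1986, and Aizenman–Duminil-Copin–Sidoravicius] -/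
def criticalTwoPoint_bounds : Prop :=
  ∀ (hd : 3 ≤ d),
    ∃ c C : ℝ, 0 < c ∧ ∀ x : Site d, x ≠ 0 →
      c * (‖x‖ : ℝ) ^ (-((d : ℝ) - 1)) ≤ criticalTwoPoint d x ∧
        criticalTwoPoint d x ≤ C * (‖x‖ : ℝ) ^ (-((d : ℝ) - 2))

/-- **crit-ising.S10** (consequence on `ℤ³`; Simon 1980, Lieb 1980, Fröhlich–Simon–Spencer 1976,
as recorded in Duminil-Copin, ICM 2022, §1, and summits/crit-ising3d/SUMMIT.md 'S' (i)–(ii)).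
If the critical correlators of the three-dimensional Ising model admit a pointwise scaling limit
`S` with renormalisation `ρ > 0` on `(0, 1]`, and `S` is scale-covariant with scaling dimension
`Δ` and has a non-degenerate two-point function, then `1/2 ≤ Δ ≤ 1`. (From
`criticalTwoPoint_bounds` with `d = 3`: scale covariance and convergence give
`ρ(δ)/ρ(δ/2) → 2^{-Δ}`, and `c n^{-2} ≤ ⟨σ₀σ_n⟩ ≤ C n^{-1}` then bounds `Δ`.) [cite: Simon1980, Lieb 1980  Fröhlich–Simon–Spencer 1976] -/
def scalingDimension_mem_Icc : Prop :=
  ∀ (ρ : ℝ → ℝ) (Δ : ℝ) (S : CorrFamily 3), HasPointwiseScalingLimit (criticalCorr 3) ρ S →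
      IsScaleCovariant Δ S → IsNondegenerateTwoPoint S → (∀ δ ∈ Set.Ioc (0 : ℝ) 1, 0 < ρ δ) →
        Δ ∈ Set.Icc (1 / 2 : ℝ) 1

end Literature.Probability.LatticeModels
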